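import Literature.AlgebraicGeometry.Motives.HodgeStructureCentralizerCenterFactorsFieldExtension
import Literature.AlgebraicGeometry.Motives.HodgeStructureLefschetzGroupCenterPointsIdempotents
import Literature.Algebra.Module.EndomorphismRingLocalIdempotents
import HarnessLib

/-!
# MILNE'S `1 = e₁ + ⋯ + e_t`, `V(A) = V₁ ⊕ ⋯ ⊕ V_t`, `V_i = e_i V` ON `K`-POINTS: THE PRIMITIVE CENTRAL IDEMPOTENTS OF `C(H)(K)` FORM
# A COMPLETE ORTHOGONAL SYSTEM INDEXED BY `MaxSpec(C₀ ⊗ K)`, `K ⊗ V = ⊕_𝔪 e_𝔪(K ⊗ V)` WITH `C(H)(K)`- AND `E_φ ⊗ K`-STABLE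
# BLOCKS, EVERY CENTRAL IDEMPOTENT IS `Σ_{𝔪 ∈ J} e_𝔪`, AND (FIRST KIND) `Z(S(H)(K))` ACTS ON EACH BLOCK BY A SIGN
# (Milne 1999 §2 p. 646; §1 p. 645 `S₀(A)(R) = {γ ∈ C₀(A) ⊗ R | γ†γ = 1}`, §2 L1–L3 «together with their actions on `V(A)`»)

[topic AlgebraicGeometry/Motives]

Layer `Literature/AlgebraicGeometry/Motives`, lane `lit-hodgefound` (Track 2 foundations library; prover seat
`lit-hodgefound-p02`, generation 56, self-proposed row g56-#7). THEOREMS ONLY: no definition, no named fact (net debt `0`),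
no instance, no notation.  Milne (§2 p. 646): «Let `F ⊗_ℚ k = F₁ × ⋯ × F_t` be the decomposition of `F ⊗_ℚ k` into a product of
fields, and let `1 = e₁ + ⋯ + e_t` be the corresponding decomposition of `1` into a sum of orthogonal idempotents. Then
`V(A) = V₁ ⊕ ⋯ ⊕ V_t`, `V_i = e_i V` … Any `k`-linear map `α : V → V` commuting with the action of `F` decomposes into
`α = α₁ ⊕ ⋯ ⊕ α_t`».  On `K`-points the tree has the centre `Z_K = Z(C(H)(K)) = C₀ ⊗ K` (g54-#2), reduced and finite-dimensional
(g55-#8), its `t_K` maximal ideals, the unique primitive idempotent `e_𝔪` of each (g56-#3 `existsUnique_isIdempotentElem_notMem_forall_mem`),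
and `Z(S(H)(K)) ≅ {idempotents of Z_K}` via `γ = 1 − 2u` for `†` of the first kind (g55-#13).  PROVED here:
(i) ALGEBRA (`Z` reduced, finite-dimensional, commutative; any family `(e_𝔪)` of primitive idempotents): `(e_𝔪)` exists as a
function; under `Z ≅ Π_𝔪 Z/𝔪` it is the family of indicator vectors; it is a COMPLETE ORTHOGONAL SYSTEM (`e_𝔪 e_𝔪' = 0`,
`Σ e_𝔪 = 1`, Mathlib's `CompleteOrthogonalIdempotents`); `e_𝔪 z = 0 ⟺ z ∈ 𝔪`; for an idempotent `u`: `1 − u ∈ 𝔪 ⟺ u ∉ 𝔪`,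
`e_𝔪 u ∈ {0, e_𝔪}` according as `u ∈ 𝔪` or not, and `u = Σ_{𝔪 ∌ u} e_𝔪`;
(ii) FOR `C(H)` (polarizable `H`): the primitive central idempotents `(e_𝔪)_{𝔪 ∈ MaxSpec Z_K}` exist; they and their underlying
endomorphisms of `K ⊗ V` form complete orthogonal systems; **`K ⊗ V = ⊕_𝔪 e_𝔪(K ⊗ V)`** (`DirectSum.IsInternal`, via the tree's
`isInternal_range_of_completeOrthogonalIdempotents`); every block `z(K ⊗ V)`, `z ∈ Z_K`, is stable under `C(H)(K)` and under the
`a_K`, `a ∈ E_φ`; and for `†` of the FIRST KIND every central `γ ∈ S(H)(K)` acts on each block `e_𝔪(K ⊗ V)` as `+1` or as `−1`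
— the `K`-points form of `S₀(K) ≅ {±1}^{t_K}` acting by sign vectors (g55-#1 is `K = ℚ` with the canonical `ℚ`-blocks).

## The sources, verbatim

* J. S. Milne, *Lefschetz classes on abelian varieties*, Duke Math. J. 96 (1999) 639–675 [Milne1999LefschetzClasses] (held
  `paper:doi-10-1215-s0012-7094-99-09620-5`): folio 7 = p. 645 L2–L14 «`C₀(A)` … is a product of fields …
  `S₀(A)(R) = {γ ∈ C₀(A) ⊗_ℚ R | γ†γ = 1}`»; folio 8 = p. 646 L33–L40 (quoted above); §2 L1–L3 «We wish to calculate `C(A)` and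
  `S(A)`, together with their actions on `V(A)`».
* B. J. J. Moonen, Yu. G. Zarhin, *Weil classes on abelian varieties* [MoonenZarhin1998WeilClasses], §1 Lemma (1).
* R. S. Pierce, *Associative Algebras*, GTM 88 (1982) [Pierce1982], §10.7 Cor. b; M. F. Atiyah, I. G. Macdonald [AtiyahMacdonald1969],
  Ch. 8 Thm. 8.7; T. Y. Lam, *A First Course in Noncommutative Rings* [Lam2001FirstCourse], §23 proof of Thm. (23.8)
  (`M = e₁M ⊕ ⋯ ⊕ e_nM` for complete orthogonal idempotents of `End(M)`).

Nearest tree results, BY NAME: g56-#3 `existsUnique_isIdempotentElem_notMem_forall_mem`, `IsIdempotentElem.eq_of_forall_mem_iff`;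
g55-#13 `Polarization.exists_isIdempotentElem_coe_eq_one_sub_of_mem_center_lefschetzGroupBaseChange`; g55-#8
`isReduced_center_centralizer_endAlg_baseChange`; `Literature.Algebra.Module.KrullSchmidt.isInternal_range_of_completeOrthogonalIdempotents`
(imported); `exists_orthogonal_idempotents_of_isReduced` (`Motives/HodgeStructureCMOddWeightCentreSkewUnit`: an abstract orthogonal
system `∃ ι e`, neither indexed by `MaxSpec` nor characterized by membership); g55-#1 (signs on the canonical `ℚ`-blocks).

## Dictionary and what is proved

`Z_K = Subalgebra.center K C(H)(K)`, "`(e_𝔪)` primitive" = `∀ 𝔪, IsIdempotentElem (e 𝔪) ∧ e 𝔪 ∉ 𝔪 ∧ ∀ 𝔪' ≠ 𝔪, e 𝔪 ∈ 𝔪'`,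
`e_𝔪(K ⊗ V) = LinearMap.range (e 𝔪).1.1`; the `Fintype ∕ DecidableEq (MaxSpec Z_K)` instances of the sum statements are arbitrary.

* §1 algebra (namespace `…Motives.HodgeStructure`): **`exists_primitiveIdempotents`**, **`equivPi_primitiveIdempotent_eq_single`**,
  **`completeOrthogonalIdempotents_primitiveIdempotents`**, **`primitiveIdempotent_mul_eq_zero_iff`**,
  `one_sub_mem_iff_notMem_of_isIdempotentElem`, **`primitiveIdempotent_mul_of_isIdempotentElem`**,
  **`eq_sum_primitiveIdempotents_of_isIdempotentElem`** (`u = Σ_{𝔪 ∌ u} e_𝔪`).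
* §2 for `C(H)`: **`exists_primitive_central_idempotents`**, **`completeOrthogonalIdempotents_primitive_central_idempotents`**,
  **`isInternal_range_primitive_central_idempotents`** (`K ⊗ V = ⊕_𝔪 e_𝔪(K ⊗ V)`), **`apply_mem_range_of_mem_center_centralizer`**
  (blocks `C(H)(K)`- and `E_φ ⊗ K`-stable), **`Polarization.forall_apply_eq_or_forall_apply_eq_neg_of_mem_center`** (first kind:
  central `γ` is `±1` on each block).
-/

noncomputable section

open scoped TensorProduct

namespace Literature.AlgebraicGeometry.Motives

namespace HodgeStructure

universe u v

/-! ## §1 Algebra: the primitive idempotents `(e_𝔪)_𝔪` of a reduced finite-dimensional commutative algebra form a complete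
orthogonal system; every idempotent is a sum of them; `e_𝔪 z = 0 ⟺ z ∈ 𝔪` -/

section Algebra

/-- **A FAMILY OF PRIMITIVE IDEMPOTENTS EXISTS**: `𝔪 ↦ e_𝔪` with `e_𝔪² = e_𝔪`, `e_𝔪 ∉ 𝔪`, `e_𝔪 ∈ 𝔪'` (`𝔪' ≠ 𝔪`) (g56-#3's `∃!`,
assembled into a function). [cite: Pierce1982, §10.7 Cor. b] [cite: AtiyahMacdonald1969, Ch. 8 Thm. 8.7] -/
theorem exists_primitiveIdempotents (K : Type u) [Field K] (Z : Type*) [CommRing Z] [Algebra K Z] [Module.Finite K Z] [IsReduced Z] :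
    ∃ e : MaximalSpectrum Z → Z, ∀ I, IsIdempotentElem (e I) ∧ e I ∉ I.asIdeal ∧ ∀ J : MaximalSpectrum Z, J ≠ I → e I ∈ J.asIdeal :=
  ⟨fun I => (existsUnique_isIdempotentElem_notMem_forall_mem K Z I).exists.choose,
    fun I => (existsUnique_isIdempotentElem_notMem_forall_mem K Z I).exists.choose_spec⟩

/-- In `Z ≅ Π_𝔪 Z/𝔪` the primitive idempotent `e_𝔪` is the indicator vector of `{𝔪}`. [cite: Pierce1982, §10.7 Cor. b] -/
theorem equivPi_primitiveIdempotent_eq_single {Z : Type*} [CommRing Z] [IsArtinianRing Z] [IsReduced Z] [DecidableEq (MaximalSpectrum Z)]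
    {e : MaximalSpectrum Z → Z}
    (he : ∀ I, IsIdempotentElem (e I) ∧ e I ∉ I.asIdeal ∧ ∀ J : MaximalSpectrum Z, J ≠ I → e I ∈ J.asIdeal) (I : MaximalSpectrum Z) :
    IsArtinianRing.equivPi Z (e I) = Pi.single I 1 := by
  funext J
  rw [IsArtinianRing.equivPi_apply]
  by_cases hJ : J = I
  · subst hJ
    rw [Pi.single_eq_same]
    have hid : IsIdempotentElem (Ideal.Quotient.mk J.asIdeal (e J)) := (he J).1.map _
    have hne : Ideal.Quotient.mk J.asIdeal (e J) ≠ 0 := fun h => (he J).2.1 (Ideal.Quotient.eq_zero_iff_mem.1 h)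
    exact (IsIdempotentElem.iff_eq_zero_or_one.1 hid).resolve_left hne
  · rw [Pi.single_eq_of_ne hJ]
    exact Ideal.Quotient.eq_zero_iff_mem.2 ((he I).2.2 J hJ)

/-- **THE PRIMITIVE IDEMPOTENTS ARE A COMPLETE ORTHOGONAL SYSTEM: `e_𝔪 e_𝔪' = 0` (`𝔪 ≠ 𝔪'`), `Σ_𝔪 e_𝔪 = 1`** — Milne's
«`1 = e₁ + ⋯ + e_t` … orthogonal idempotents». [cite: Milne1999LefschetzClasses, §2 p. 646 L33–L36] [cite: Pierce1982, §10.7 Cor. b] -/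
theorem completeOrthogonalIdempotents_primitiveIdempotents (K : Type u) [Field K] {Z : Type*} [CommRing Z] [Algebra K Z] [Module.Finite K Z] [IsReduced Z]
    [Fintype (MaximalSpectrum Z)] {e : MaximalSpectrum Z → Z}
    (he : ∀ I, IsIdempotentElem (e I) ∧ e I ∉ I.asIdeal ∧ ∀ J : MaximalSpectrum Z, J ≠ I → e I ∈ J.asIdeal) :
    CompleteOrthogonalIdempotents e := by
  classical
  haveI : IsArtinianRing Z := IsArtinianRing.of_finite K Z
  refine ⟨⟨fun I => (he I).1, fun I J hIJ => (IsArtinianRing.equivPi Z).injective ?_⟩, (IsArtinianRing.equivPi Z).injective ?_⟩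
  · rw [map_mul, map_zero, equivPi_primitiveIdempotent_eq_single he, equivPi_primitiveIdempotent_eq_single he]
    funext L
    rw [Pi.mul_apply, Pi.zero_apply]
    by_cases hL : L = I
    · subst hL
      rw [Pi.single_eq_same, Pi.single_eq_of_ne hIJ, mul_zero]
    · rw [Pi.single_eq_of_ne hL, zero_mul]
  · rw [map_sum, map_one]
    simp_rw [equivPi_primitiveIdempotent_eq_single he]
    exact Finset.univ_sum_single (fun _ : MaximalSpectrum Z => (1 : _))

/-- **`e_𝔪 z = 0 ⟺ z ∈ 𝔪`**: the `𝔪`-component of `z` is cut out by `e_𝔪`. [cite: Pierce1982, §10.7 Cor. b] -/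
theorem primitiveIdempotent_mul_eq_zero_iff (K : Type u) [Field K] {Z : Type*} [CommRing Z] [Algebra K Z] [Module.Finite K Z] [IsReduced Z] {e : MaximalSpectrum Z → Z}
    (he : ∀ I, IsIdempotentElem (e I) ∧ e I ∉ I.asIdeal ∧ ∀ J : MaximalSpectrum Z, J ≠ I → e I ∈ J.asIdeal)
    (I : MaximalSpectrum Z) (z : Z) : e I * z = 0 ↔ z ∈ I.asIdeal := by
  classical
  haveI : IsArtinianRing Z := IsArtinianRing.of_finite K Z
  constructor
  · intro h
    have h' := congrFun (congrArg (IsArtinianRing.equivPi Z) h) I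
    rw [map_mul, map_zero, Pi.mul_apply, equivPi_primitiveIdempotent_eq_single he, Pi.single_eq_same, one_mul, Pi.zero_apply,
      IsArtinianRing.equivPi_apply] at h'
    exact Ideal.Quotient.eq_zero_iff_mem.1 h'
  · intro h
    apply (IsArtinianRing.equivPi Z).injective
    rw [map_mul, map_zero, equivPi_primitiveIdempotent_eq_single he]
    funext J
    rw [Pi.mul_apply, Pi.zero_apply]
    by_cases hJ : J = I
    · subst hJ
      rw [Pi.single_eq_same, one_mul, IsArtinianRing.equivPi_apply]
      exact Ideal.Quotient.eq_zero_iff_mem.2 h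
    · rw [Pi.single_eq_of_ne hJ, zero_mul]

/-- For an idempotent `u` and a maximal `𝔪`: `1 − u ∈ 𝔪 ⟺ u ∉ 𝔪` (`u ≡ 0` or `1 (mod 𝔪)`). [cite: Pierce1982, §10.7 Cor. b] -/
theorem one_sub_mem_iff_notMem_of_isIdempotentElem {Z : Type*} [CommRing Z] {u : Z} (hu : IsIdempotentElem u) (I : MaximalSpectrum Z) :
    1 - u ∈ I.asIdeal ↔ u ∉ I.asIdeal := by
  haveI := I.isMaximal
  constructor
  · intro h hu'
    exact I.isMaximal.ne_top ((Ideal.eq_top_iff_one _).2 (by simpa using I.asIdeal.add_mem h hu'))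
  · intro h
    have hid : IsIdempotentElem (Ideal.Quotient.mk I.asIdeal u) := hu.map _
    have hne : Ideal.Quotient.mk I.asIdeal u ≠ 0 := fun h' => h (Ideal.Quotient.eq_zero_iff_mem.1 h')
    haveI : Field (Z ⧸ I.asIdeal) := Ideal.Quotient.field I.asIdeal
    have h1 : Ideal.Quotient.mk I.asIdeal u = 1 := (IsIdempotentElem.iff_eq_zero_or_one.1 hid).resolve_left hne
    rw [← Ideal.Quotient.eq_zero_iff_mem, map_sub, map_one, h1, sub_self]

/-- **`e_𝔪 u = e_𝔪` OR `e_𝔪 u = 0` FOR AN IDEMPOTENT `u`, ACCORDING AS `u ∉ 𝔪` OR `u ∈ 𝔪`.** [cite: Pierce1982, §10.7 Cor. b] -/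
theorem primitiveIdempotent_mul_of_isIdempotentElem (K : Type u) [Field K] {Z : Type*} [CommRing Z] [Algebra K Z] [Module.Finite K Z] [IsReduced Z] {e : MaximalSpectrum Z → Z}
    (he : ∀ I, IsIdempotentElem (e I) ∧ e I ∉ I.asIdeal ∧ ∀ J : MaximalSpectrum Z, J ≠ I → e I ∈ J.asIdeal)
    (I : MaximalSpectrum Z) {u : Z} (hu : IsIdempotentElem u) :
    (u ∈ I.asIdeal → e I * u = 0) ∧ (u ∉ I.asIdeal → e I * u = e I) := by
  refine ⟨fun h => (primitiveIdempotent_mul_eq_zero_iff K he I u).2 h, fun h => ?_⟩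
  have h1 : e I * (1 - u) = 0 :=
    (primitiveIdempotent_mul_eq_zero_iff K he I (1 - u)).2 ((one_sub_mem_iff_notMem_of_isIdempotentElem hu I).2 h)
  rw [mul_sub, mul_one, sub_eq_zero] at h1
  exact h1.symm

/-- **EVERY IDEMPOTENT IS THE SUM OF THE PRIMITIVE IDEMPOTENTS OUTSIDE WHICH IT LIES: `u = Σ_{𝔪 ∌ u} e_𝔪`** (the `2^t` idempotents
`e_J = Σ_{𝔪 ∈ J} e_𝔪`). [cite: Milne1999LefschetzClasses, §2 p. 646 L33–L36] [cite: Pierce1982, §10.7 Cor. b] -/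
theorem eq_sum_primitiveIdempotents_of_isIdempotentElem (K : Type u) [Field K] {Z : Type*} [CommRing Z] [Algebra K Z] [Module.Finite K Z] [IsReduced Z] {e : MaximalSpectrum Z → Z}
    (he : ∀ I, IsIdempotentElem (e I) ∧ e I ∉ I.asIdeal ∧ ∀ J : MaximalSpectrum Z, J ≠ I → e I ∈ J.asIdeal)
    {u : Z} (hu : IsIdempotentElem u) (S : Finset (MaximalSpectrum Z)) (hS : ∀ I, I ∈ S ↔ u ∉ I.asIdeal) :
    u = ∑ I ∈ S, e I := by
  classical
  haveI : IsArtinianRing Z := IsArtinianRing.of_finite K Z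
  apply (IsArtinianRing.equivPi Z).injective
  funext J
  rw [map_sum, Finset.sum_apply]
  simp_rw [equivPi_primitiveIdempotent_eq_single he]
  rw [IsArtinianRing.equivPi_apply]
  by_cases hJ : u ∈ J.asIdeal
  · rw [Finset.sum_eq_zero (fun I hI => Pi.single_eq_of_ne (fun h : J = I => (hS I).1 hI (h ▸ hJ)) _)]
    exact Ideal.Quotient.eq_zero_iff_mem.2 hJ
  · rw [Finset.sum_eq_single_of_mem J ((hS J).2 hJ) (fun I _ hIJ => Pi.single_eq_of_ne (Ne.symm hIJ) _), Pi.single_eq_same]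
    have hid : IsIdempotentElem (Ideal.Quotient.mk J.asIdeal u) := hu.map _
    have hne : Ideal.Quotient.mk J.asIdeal u ≠ 0 := fun h' => hJ (Ideal.Quotient.eq_zero_iff_mem.1 h')
    exact (IsIdempotentElem.iff_eq_zero_or_one.1 hid).resolve_left hne

end Algebra

/-! ## §2 Milne's `1 = e₁ + ⋯ + e_t`, `V(A) = V₁ ⊕ ⋯ ⊕ V_t`, `V_i = e_i V` ON `K`-POINTS: the primitive central idempotents of
`C(H)(K)` decompose `K ⊗ V` into `E_φ ⊗ K`- and `C(H)(K)`-stable blocks on which the centre of `S(H)(K)` acts by signs -/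

section Blocks

variable (K : Type u) [Field K] [Algebra ℚ K] {V : Type v} [AddCommGroup V] [Module ℚ V] [Module.Finite ℚ V] {n : ℤ}
  (H : HodgeStructure V n)

set_option maxSynthPendingDepth 4 in
/-- The standing instance on `Z_K`: finite-dimensional over `K`. [folklore] -/
private theorem finite_center_centralizer₅₆₇ :
    Module.Finite K (Subalgebra.center K (Subalgebra.centralizer K
      ((fun a : Module.End ℚ V => a.baseChange K) '' (H.endAlg : Set (Module.End ℚ V))))) := by
  haveI := finite_centralizer_endAlg_baseChange K H
  haveI : IsNoetherian K (Subalgebra.centralizer K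
      ((fun a : Module.End ℚ V => a.baseChange K) '' (H.endAlg : Set (Module.End ℚ V)))) :=
    isNoetherian_of_isNoetherianRing_of_finite K _
  exact Module.Finite.of_injective (Subalgebra.val _).toLinearMap Subtype.val_injective

set_option maxSynthPendingDepth 4 in
/-- **THE PRIMITIVE CENTRAL IDEMPOTENTS `(e_𝔪)` OF `C(H)(K)` EXIST** (polarizable `H`): Milne's `e₁, …, e_t` for `C₀ ⊗ K = F₁ × ⋯ × F_t`.
[cite: Milne1999LefschetzClasses, §2 p. 646 L33–L36 and §1 p. 645 L2–L6] [cite: Pierce1982, §10.7 Cor. b] -/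
theorem exists_primitive_central_idempotents (hH : H.IsPolarizable) :
    ∃ e : MaximalSpectrum (Subalgebra.center K (Subalgebra.centralizer K
          ((fun a : Module.End ℚ V => a.baseChange K) '' (H.endAlg : Set (Module.End ℚ V))))) →
        Subalgebra.center K (Subalgebra.centralizer K
          ((fun a : Module.End ℚ V => a.baseChange K) '' (H.endAlg : Set (Module.End ℚ V)))),
      ∀ I, IsIdempotentElem (e I) ∧ e I ∉ I.asIdeal ∧ ∀ J, J ≠ I → e I ∈ J.asIdeal := by
  haveI := finite_center_centralizer₅₆₇ K H
  haveI := isReduced_center_centralizer_endAlg_baseChange K hH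
  exact exists_primitiveIdempotents K _

variable {H}

set_option maxSynthPendingDepth 4 in
/-- **`1 = e₁ + ⋯ + e_t` IN `C(H)(K)`, ORTHOGONALLY, AND ALSO AS ENDOMORPHISMS OF `K ⊗ V`** (polarizable `H`).
[cite: Milne1999LefschetzClasses, §2 p. 646 L33–L36] [cite: Pierce1982, §10.7 Cor. b] -/
theorem completeOrthogonalIdempotents_primitive_central_idempotents (hH : H.IsPolarizable)
    [Fintype (MaximalSpectrum (Subalgebra.center K (Subalgebra.centralizer K
      ((fun a : Module.End ℚ V => a.baseChange K) '' (H.endAlg : Set (Module.End ℚ V))))))]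
    {e : MaximalSpectrum (Subalgebra.center K (Subalgebra.centralizer K
          ((fun a : Module.End ℚ V => a.baseChange K) '' (H.endAlg : Set (Module.End ℚ V))))) →
        Subalgebra.center K (Subalgebra.centralizer K
          ((fun a : Module.End ℚ V => a.baseChange K) '' (H.endAlg : Set (Module.End ℚ V))))}
    (he : ∀ I, IsIdempotentElem (e I) ∧ e I ∉ I.asIdeal ∧ ∀ J, J ≠ I → e I ∈ J.asIdeal) :
    CompleteOrthogonalIdempotents e ∧ CompleteOrthogonalIdempotents fun I => ((e I).1.1 : Module.End K (K ⊗[ℚ] V)) := by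
  haveI := finite_center_centralizer₅₆₇ K H
  haveI := isReduced_center_centralizer_endAlg_baseChange K hH
  have h := completeOrthogonalIdempotents_primitiveIdempotents K he
  refine ⟨h, ?_⟩
  exact h.map (((Subalgebra.centralizer K ((fun a : Module.End ℚ V => a.baseChange K) ''
      (H.endAlg : Set (Module.End ℚ V)))).val.comp (Subalgebra.center K (Subalgebra.centralizer K
      ((fun a : Module.End ℚ V => a.baseChange K) '' (H.endAlg : Set (Module.End ℚ V))))).val).toRingHom)

set_option maxSynthPendingDepth 4 in
/-- **MILNE'S `V(A) = V₁ ⊕ ⋯ ⊕ V_t`, `V_i = e_i V`, ON `K`-POINTS: `K ⊗ V = ⊕_𝔪 e_𝔪(K ⊗ V)`** over the maximal ideals `𝔪` of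
`C₀ ⊗ K` (polarizable `H`; internal direct sum of the ranges of the primitive central idempotents).
[cite: Milne1999LefschetzClasses, §2 p. 646 L33–L38] [cite: Lam2001FirstCourse, §23 proof of Thm. (23.8)] -/
theorem isInternal_range_primitive_central_idempotents (hH : H.IsPolarizable)
    [Fintype (MaximalSpectrum (Subalgebra.center K (Subalgebra.centralizer K
      ((fun a : Module.End ℚ V => a.baseChange K) '' (H.endAlg : Set (Module.End ℚ V))))))]
    [DecidableEq (MaximalSpectrum (Subalgebra.center K (Subalgebra.centralizer K
      ((fun a : Module.End ℚ V => a.baseChange K) '' (H.endAlg : Set (Module.End ℚ V))))))]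
    {e : MaximalSpectrum (Subalgebra.center K (Subalgebra.centralizer K
          ((fun a : Module.End ℚ V => a.baseChange K) '' (H.endAlg : Set (Module.End ℚ V))))) →
        Subalgebra.center K (Subalgebra.centralizer K
          ((fun a : Module.End ℚ V => a.baseChange K) '' (H.endAlg : Set (Module.End ℚ V))))}
    (he : ∀ I, IsIdempotentElem (e I) ∧ e I ∉ I.asIdeal ∧ ∀ J, J ≠ I → e I ∈ J.asIdeal) :
    DirectSum.IsInternal fun I => LinearMap.range ((e I).1.1 : Module.End K (K ⊗[ℚ] V)) :=
  Literature.Algebra.Module.KrullSchmidt.isInternal_range_of_completeOrthogonalIdempotents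
    (completeOrthogonalIdempotents_primitive_central_idempotents K hH he).2

set_option maxSynthPendingDepth 4 in
omit [Module.Finite ℚ V] in
/-- **EACH BLOCK `e_𝔪(K ⊗ V)` IS STABLE UNDER `C(H)(K)` (in particular under `S(H)(K)`) AND UNDER `E_φ ⊗ K`** (`e_𝔪` is central in
`C(H)(K)` and commutes with the `a_K`): Milne's «any `k`-linear map `α` commuting with the action of `F` decomposes into
`α = α₁ ⊕ ⋯ ⊕ α_t`, `α_i : V_i → V_i`». [cite: Milne1999LefschetzClasses, §2 p. 646 L38–L40] -/
theorem apply_mem_range_of_mem_center_centralizer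
    (z : Subalgebra.center K (Subalgebra.centralizer K
        ((fun a : Module.End ℚ V => a.baseChange K) '' (H.endAlg : Set (Module.End ℚ V))))) :
    (∀ c ∈ Subalgebra.centralizer K ((fun a : Module.End ℚ V => a.baseChange K) '' (H.endAlg : Set (Module.End ℚ V))),
        ∀ v ∈ LinearMap.range (z.1.1 : Module.End K (K ⊗[ℚ] V)), c v ∈ LinearMap.range (z.1.1 : Module.End K (K ⊗[ℚ] V))) ∧
      ∀ a ∈ H.endAlg, ∀ v ∈ LinearMap.range (z.1.1 : Module.End K (K ⊗[ℚ] V)),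
        a.baseChange K v ∈ LinearMap.range (z.1.1 : Module.End K (K ⊗[ℚ] V)) := by
  constructor
  · rintro c hc _ ⟨w, rfl⟩
    have hcz : c * (z.1.1 : Module.End K (K ⊗[ℚ] V)) = z.1.1 * c :=
      congrArg Subtype.val (Subalgebra.mem_center_iff.1 z.2 ⟨c, hc⟩)
    exact ⟨c w, by rw [← Module.End.mul_apply, ← hcz, Module.End.mul_apply]⟩
  · rintro a ha _ ⟨w, rfl⟩
    have haz : a.baseChange K * (z.1.1 : Module.End K (K ⊗[ℚ] V)) = z.1.1 * a.baseChange K :=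
      (Subalgebra.mem_centralizer_iff K).1 z.1.2 _ ⟨a, ha, rfl⟩
    exact ⟨a.baseChange K w, by rw [← Module.End.mul_apply, ← haz, Module.End.mul_apply]⟩

set_option maxSynthPendingDepth 4 in
/-- **FIRST KIND: A CENTRAL `γ ∈ S(H)(K)` ACTS ON EACH BLOCK `e_𝔪(K ⊗ V)` BY A SIGN** — `γ = 1 − 2u` for an idempotent `u ∈ C₀ ⊗ K`
(g55-#13) and `e_𝔪 u ∈ {0, e_𝔪}`: the `K`-points version of «`S₀(A)(R) = {γ ∈ C₀(A) ⊗ R | γ†γ = 1}` together with its action on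
`V(A)`», `S₀(K) ≅ {±1}^{t_K}` acting through the sign vector on `V₁ ⊕ ⋯ ⊕ V_{t_K}` (g55-#1 is the case `K = ℚ`).
[cite: Milne1999LefschetzClasses, §1 p. 645 L2–L14 (S₀, Prop. 1.7), §2 L1–L3 and p. 646 L33–L38] [cite: MoonenZarhin1998WeilClasses, §1 Lemma (1)] -/
theorem Polarization.forall_apply_eq_or_forall_apply_eq_neg_of_mem_center (ψ : Polarization H)
    (hfix : ∀ z : H.endAlg, z ∈ Subalgebra.center ℚ H.endAlg → ψ.adjoint (z : Module.End ℚ V) = z)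
    {e : MaximalSpectrum (Subalgebra.center K (Subalgebra.centralizer K
          ((fun a : Module.End ℚ V => a.baseChange K) '' (H.endAlg : Set (Module.End ℚ V))))) →
        Subalgebra.center K (Subalgebra.centralizer K
          ((fun a : Module.End ℚ V => a.baseChange K) '' (H.endAlg : Set (Module.End ℚ V))))}
    (he : ∀ I, IsIdempotentElem (e I) ∧ e I ∉ I.asIdeal ∧ ∀ J, J ≠ I → e I ∈ J.asIdeal)
    {γ : ψ.lefschetzGroupBaseChange K} (hγ : γ ∈ Subgroup.center (ψ.lefschetzGroupBaseChange K))
    (I : MaximalSpectrum (Subalgebra.center K (Subalgebra.centralizer K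
      ((fun a : Module.End ℚ V => a.baseChange K) '' (H.endAlg : Set (Module.End ℚ V)))))) :
    (∀ v ∈ LinearMap.range ((e I).1.1 : Module.End K (K ⊗[ℚ] V)), (γ : (K ⊗[ℚ] V) ≃ₗ[K] (K ⊗[ℚ] V)) v = v) ∨
      (∀ v ∈ LinearMap.range ((e I).1.1 : Module.End K (K ⊗[ℚ] V)), (γ : (K ⊗[ℚ] V) ≃ₗ[K] (K ⊗[ℚ] V)) v = -v) := by
  haveI := finite_center_centralizer₅₆₇ K H
  haveI := isReduced_center_centralizer_endAlg_baseChange K ⟨ψ⟩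
  obtain ⟨u, hu, hγu⟩ := ψ.exists_isIdempotentElem_coe_eq_one_sub_of_mem_center_lefschetzGroupBaseChange K hfix hγ
  have hγv : ∀ v, (γ : (K ⊗[ℚ] V) ≃ₗ[K] (K ⊗[ℚ] V)) v = v - ((u.1.1 : Module.End K (K ⊗[ℚ] V)) v + (u.1.1 : Module.End K (K ⊗[ℚ] V)) v) :=
    fun v => by
    have h := congrArg (fun f : Module.End K (K ⊗[ℚ] V) => f v) hγu
    simpa only [LinearEquiv.coe_coe, LinearMap.sub_apply, Module.End.one_apply, LinearMap.add_apply] using h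
  have hmul := primitiveIdempotent_mul_of_isIdempotentElem K he I hu
  -- `u e_𝔪 = e_𝔪 u` as endomorphisms, read off in `Z_K`
  have key : ∀ w, (u.1.1 : Module.End K (K ⊗[ℚ] V)) ((e I).1.1 w) = ((e I * u).1.1 : Module.End K (K ⊗[ℚ] V)) w := fun w => by
    rw [mul_comm, ← Module.End.mul_apply]
    rfl
  by_cases huI : u ∈ I.asIdeal
  · left
    rintro _ ⟨w, rfl⟩
    rw [hγv, key, hmul.1 huI]
    change (e I).1.1 w - ((0 : Module.End K (K ⊗[ℚ] V)) w + (0 : Module.End K (K ⊗[ℚ] V)) w) = (e I).1.1 w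
    rw [LinearMap.zero_apply, add_zero, sub_zero]
  · right
    rintro _ ⟨w, rfl⟩
    rw [hγv, key, hmul.2 huI]
    change (e I).1.1 w - ((e I).1.1 w + (e I).1.1 w) = -(e I).1.1 w
    abel

end Blocks

end HodgeStructure

end Literature.AlgebraicGeometry.Motives
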